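import Summits.Ventures.Crystal3D.Theorems.StickyWulffConstantGenericWallFloorDiscRowCount
import HarnessLib

/-!
# (β) plates side, input (b): FLUX-TO-AREA — the lattice-line flux of a clamped plate is `√2·π·(Σ_r (Fr r)₂)·(ρ−4)² − O(ρ)`
# (lane T, crux `TextureLiminfV5`, stmt-Ventures-23912, registered stub `stub_terraceCensus`; BETA-PLATES-g23 §3 (i) / §4 (3), closing block (8)(d) item (b))

HONEST FRAMING. Venture `Summits/Ventures/Crystal3D` (cell `crystal3d-full`), route `route-Ventures-StickyWulffConstant`, helper `--supports` the
law-v5 crux `TextureLiminfV5` (stmt-Ventures-23912), lane T.  Pure real analysis and bookkeeping, standard axioms; census-free, certificate-free;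
nothing about energies; F-C1 not moved.

THE POINT.  The (β) plates side is in the tree as «`flux₁(Kw₁) + flux₂(Kw₂) ≤ sF·Σ_PAY(12 − deg) + ΣCUT₁ + ΣCUT₂ + O(ρ)`»
(`hexagon_twoPlate_flux_le_payerSum` …LevelReachHexagonPooledFlux, `…_root` …HexagonPooledFluxRoot, `…twice…_of_gradedWin₃` …HexagonGradedGlue),
with lane F's lattice-line flux (`oneFcc_srcA_ge`, …OneFccFluxF) for ANY finite layer sets `Kw_i`:
`flux(Kw) = Σ_{k ∈ Kw, k t-admissible} (Φ·G_k − #RT)`, `Φ = 4V/(√3 S²)`, `V = Σ_{r ∈ RT} (Fr r)₂`, `S² = 1 − ν₂²`,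
`G_k = √(((ρ−4)² S² − x_k²)₊)`, `x_k = k·√(2/3) + ψ − z·ν₂` (a half-chord of the disc of radius `(ρ−4)·S` sampled on the arithmetic
progression of the layer planes' traces).  This file evaluates that flux against the AREA of the cell (the currency of the charge,
`two_charge_le_const`): with the canonical window `Kw⋆ = {k : |x_k| ≤ (ρ−4)S}`,
* **`disc_profile_ap_sum_ge`** — the arithmetic-progression Riemann LOWER sum of the disc profile: for `m ≥ 0`, `d > 0` and every finite `K ⊇ {k : (k d + c)² < m²}`,
  `π m²/(2d) − m ≤ Σ_{k ∈ K} √((m² − (k d + c)²)₊)` (the lower companion of `sum_sqrt_sq_sub_sq_le_of_separated`, …GenericWallFloorDiscRowCount: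
  each sample dominates the integral over the adjacent step AWAY from `0`; only the step containing `0` is lost);
* **`plate_window_core`** / **`plate_flux_ge_area`** — in the VERBATIM summand shape of the pooled theorems (abstract `σ, t, V, ν, ψ, z, ρ, n`;
  bottom plate: `V = Σ_{r ∈ inPlaneRoots Fr 1} (Fr r)₂`, `ν = (L₁⁻¹e₃)₂`, `ψ = (L₁⁻¹s₁)₂`, `z = −(R₀+1)−1`, `n = #RT₁`; top plate:
  `V = Σ_{r ∈ inPlaneRoots G₂ (−1)} −(G₂ r)₂`, `z = h+(R₀+1)+1`): if every layer of the window is `t`-admissible (`¬(σ(k−1) = −t ∧ σ k = −t)`; hcp-like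
  words for both types, an fcc word for its own type) then `√2·π·V·(ρ−4)² − 5·n·ρ ≤ flux_t(Kw⋆)` (using `0 ≤ V ≤ n·S`, `ν² ≤ 1`, `ρ ≥ 4`;
  `√3·√(2/3) = √2` turns `Φ·π m²/(2d)` into `√2 π V (ρ−4)²`; the error is tilt-uniform because `Φ·m = 4V(ρ−4)/(√3 S) ≤ 4n(ρ−4)/√3`);
* **`plate_flux_two_types_ge_area`** — for ANY word: every layer is admissible for at least one of two different types `t ≠ t'`, so on the
  profitable window `Kw⋆⋆ = {k ∈ Kw⋆ : n ≤ Φ G_k}` the two fluxes together dominate the same bound (no admissibility hypothesis).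
The cell instances (the hypotheses `V ≤ n·S`, `ν² ≤ 1` discharged from `Fr r = L r` on basal `r`, and the composition with
`hexagon_twoPlate_flux_le_payerSum`) are the companion file …LevelReachPlatesFluxAreaCell.
WHAT THIS IS NOT: the row, the CUT bounds, the born-line supply, the assembly; no evaluation of `V` (a function of the tilt and azimuth of the plate);
F-C1 not moved.
-/

noncomputable section

namespace Summit.Ventures.Crystal3D.Theorems

open MeasureTheory Set Finset intervalIntegral

/-! ## The disc profile sampled on an arithmetic progression: the Riemann LOWER sum -/

/-- The disc profile `g(x) = √((m² − x²)₊)`: continuous, `0 ≤ g ≤ m`, even, antitone in `|x|`, equal to `√(m² − x²)` on `[−m, m]`. -/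
theorem disc_profile_basic (m : ℝ) (hm : 0 ≤ m) :
    (Continuous fun x : ℝ => Real.sqrt (max 0 (m ^ 2 - x ^ 2))) ∧
    (∀ x : ℝ, 0 ≤ Real.sqrt (max 0 (m ^ 2 - x ^ 2))) ∧
    (∀ x : ℝ, Real.sqrt (max 0 (m ^ 2 - x ^ 2)) ≤ m) ∧
    (∀ x y : ℝ, |x| ≤ |y| → Real.sqrt (max 0 (m ^ 2 - y ^ 2)) ≤ Real.sqrt (max 0 (m ^ 2 - x ^ 2))) ∧
    (∀ x : ℝ, |x| ≤ m → Real.sqrt (max 0 (m ^ 2 - x ^ 2)) = Real.sqrt (m ^ 2 - x ^ 2)) := by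
  refine ⟨by fun_prop, fun x => Real.sqrt_nonneg _, fun x => ?_, fun x y hxy => ?_, fun x hx => ?_⟩
  · calc Real.sqrt (max 0 (m ^ 2 - x ^ 2)) ≤ Real.sqrt (m ^ 2) :=
          Real.sqrt_le_sqrt (max_le (sq_nonneg m) (by nlinarith [sq_nonneg x]))
      _ = m := Real.sqrt_sq hm
  · have := sq_le_sq.2 hxy
    exact Real.sqrt_le_sqrt (max_le_max le_rfl (by linarith))
  · have h : 0 ≤ m ^ 2 - x ^ 2 := by
      have := sq_le_sq.2 (show |x| ≤ |m| by rwa [abs_of_nonneg hm]); nlinarith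
    rw [max_eq_right h]

/-- `∫_{−m}^{m} √((m² − x²)₊) dx = π m²/2`. -/
theorem integral_disc_profile (m : ℝ) (hm : 0 ≤ m) :
    ∫ x in (-m)..m, Real.sqrt (max 0 (m ^ 2 - x ^ 2)) = Real.pi * m ^ 2 / 2 := by
  obtain ⟨hcont, -, -, -, heq⟩ := disc_profile_basic m hm
  have hint : ∀ a b : ℝ, IntervalIntegrable (fun x : ℝ => Real.sqrt (max 0 (m ^ 2 - x ^ 2))) volume a b :=
    fun a b => hcont.intervalIntegrable a b
  have hI := integral_sqrt_sq_sub_sq hm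
  -- on `[0, m]`
  have hpos : ∫ x in (0 : ℝ)..m, Real.sqrt (max 0 (m ^ 2 - x ^ 2)) = Real.pi * m ^ 2 / 4 := by
    rw [← hI]
    refine intervalIntegral.integral_congr fun x hx => ?_
    rw [Set.uIcc_of_le hm] at hx
    exact heq x (by rw [abs_of_nonneg hx.1]; exact hx.2)
  -- on `[−m, 0]`, by evenness
  have hneg : ∫ x in (-m)..0, Real.sqrt (max 0 (m ^ 2 - x ^ 2)) = Real.pi * m ^ 2 / 4 := by
    have h := intervalIntegral.integral_comp_neg (a := (0 : ℝ)) (b := m) (fun x : ℝ => Real.sqrt (max 0 (m ^ 2 - x ^ 2)))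
    simp only [neg_zero, even_two, Even.neg_pow] at h
    rw [← h, hpos]
  have hsplit := intervalIntegral.integral_add_adjacent_intervals (hint (-m) 0) (hint 0 m)
  rw [← hsplit, hneg, hpos]
  ring

/-- **The arithmetic-progression Riemann LOWER sum of the disc profile.**  For `m ≥ 0`, `d > 0`, any phase `c` and every finite set of
integers `K` containing every `k` with `(k·d + c)² < m²`:  `π·m²/(2d) − m ≤ Σ_{k ∈ K} √((m² − (k·d + c)²)₊)`. -/
theorem disc_profile_ap_sum_ge (m d c : ℝ) (hm : 0 ≤ m) (hd : 0 < d) (K : Finset ℤ)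
    (hK : ∀ k : ℤ, ((k : ℝ) * d + c) ^ 2 < m ^ 2 → k ∈ K) :
    Real.pi * m ^ 2 / (2 * d) - m ≤ ∑ k ∈ K, Real.sqrt (max 0 (m ^ 2 - ((k : ℝ) * d + c) ^ 2)) := by
  classical
  -- the profile
  obtain ⟨g, hg⟩ : ∃ g : ℝ → ℝ, ∀ x, g x = Real.sqrt (max 0 (m ^ 2 - x ^ 2)) := ⟨_, fun _ => rfl⟩
  obtain ⟨hcont, hg0, hgm, hanti, -⟩ := disc_profile_basic m hm
  have hcontg : Continuous g := by simpa only [← hg] using hcont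
  have hint : ∀ a b : ℝ, IntervalIntegrable g volume a b := fun a b => hcontg.intervalIntegrable a b
  have hg0' : ∀ x, 0 ≤ g x := fun x => by rw [hg]; exact hg0 x
  have hgm' : ∀ x, g x ≤ m := fun x => by rw [hg]; exact hgm x
  have hanti' : ∀ x y : ℝ, |x| ≤ |y| → g y ≤ g x := fun x y h => by rw [hg, hg]; exact hanti x y h
  have hItot : ∫ x in (-m)..m, g x = Real.pi * m ^ 2 / 2 := by simp only [hg]; exact integral_disc_profile m hm
  simp only [← hg]
  -- the sample points
  set x : ℤ → ℝ := fun k => (k : ℝ) * d + c with hx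
  set k₀ : ℤ := ⌊-c / d⌋ with hk₀
  have hx₀ : x k₀ ≤ 0 := by
    have h2 : ((⌊-c / d⌋ : ℤ) : ℝ) * d ≤ -c / d * d := mul_le_mul_of_nonneg_right (Int.floor_le _) hd.le
    rw [div_mul_cancel₀ _ hd.ne'] at h2; simp only [hx, hk₀]; linarith
  have hx₁ : 0 < x (k₀ + 1) := by
    have h2 : -c / d * d < (((⌊-c / d⌋ : ℤ) : ℝ) + 1) * d := mul_lt_mul_of_pos_right (Int.lt_floor_add_one _) hd
    rw [div_mul_cancel₀ _ hd.ne'] at h2; simp only [hx, hk₀]; push_cast; linarith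
  set N : ℕ := ⌈m / d⌉₊ with hN
  have hNd : m ≤ (N : ℝ) * d := by
    have h2 := mul_le_mul_of_nonneg_right (Nat.le_ceil (m / d)) hd.le
    rwa [div_mul_cancel₀ _ hd.ne'] at h2
  -- per-step bounds on the POSITIVE side: `∫_{x_k}^{x_k + d} g ≤ d · g(x_k)` for `x_k ≥ 0`
  set aP : ℕ → ℝ := fun i => x (k₀ + 1) + (i : ℝ) * d with haP
  have hstepP : ∀ i : ℕ, ∫ y in (aP i)..(aP (i + 1)), g y ≤ d * g (x (k₀ + 1 + i)) := by
    intro i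
    have hxi : x (k₀ + 1 + i) = aP i := by simp only [hx, haP]; push_cast; ring
    have hai : aP (i + 1) = aP i + d := by simp only [haP]; push_cast; ring
    have hxi0 : 0 ≤ aP i := by simp only [haP]; exact add_nonneg hx₁.le (mul_nonneg (Nat.cast_nonneg _) hd.le)
    have hc : ∫ _ in (aP i)..(aP (i + 1)), g (aP i) = d * g (x (k₀ + 1 + i)) := by
      rw [intervalIntegral.integral_const, smul_eq_mul, hxi, hai]; ring
    rw [← hc]
    refine intervalIntegral.integral_mono_on (by rw [hai]; linarith) (hint _ _) intervalIntegrable_const fun y hy => ?_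
    exact hanti' _ _ (by rw [abs_of_nonneg hxi0, abs_of_nonneg (hxi0.trans hy.1)]; exact hy.1)
  have hsumP : ∫ y in (aP 0)..(aP N), g y ≤ d * ∑ i ∈ Finset.range N, g (x (k₀ + 1 + i)) := by
    rw [← intervalIntegral.sum_integral_adjacent_intervals fun i _ => hint _ _, Finset.mul_sum]
    exact Finset.sum_le_sum fun i _ => hstepP i
  -- per-step bounds on the NEGATIVE side: `∫_{x_k − d}^{x_k} g ≤ d · g(x_k)` for `x_k ≤ 0`
  set aM : ℕ → ℝ := fun i => x k₀ - (N : ℝ) * d + (i : ℝ) * d with haM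
  have hstepM : ∀ i : ℕ, i < N → ∫ y in (aM i)..(aM (i + 1)), g y ≤ d * g (x (k₀ - N + 1 + i)) := by
    intro i hi
    have hxi : x (k₀ - N + 1 + i) = aM (i + 1) := by simp only [hx, haM]; push_cast; ring
    have hai : aM (i + 1) = aM i + d := by simp only [haM]; push_cast; ring
    have hxi0 : aM (i + 1) ≤ 0 := by
      have hi' : ((i : ℕ) : ℝ) + 1 ≤ N := by exact_mod_cast hi
      have : aM (i + 1) = x k₀ - ((N : ℝ) - (i + 1)) * d := by simp only [haM]; push_cast; ring
      rw [this]
      nlinarith [mul_nonneg (show (0 : ℝ) ≤ (N : ℝ) - (i + 1) by linarith) hd.le]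
    have hc : ∫ _ in (aM i)..(aM (i + 1)), g (aM (i + 1)) = d * g (x (k₀ - N + 1 + i)) := by
      rw [intervalIntegral.integral_const, smul_eq_mul, hxi, hai]; ring
    rw [← hc]
    refine intervalIntegral.integral_mono_on (by rw [hai]; linarith) (hint _ _) intervalIntegrable_const fun y hy => ?_
    exact hanti' _ _ (by rw [abs_of_nonpos hxi0, abs_of_nonpos (hy.2.trans hxi0)]; linarith [hy.2])
  have hsumM : ∫ y in (aM 0)..(aM N), g y ≤ d * ∑ i ∈ Finset.range N, g (x (k₀ - N + 1 + i)) := by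
    rw [← intervalIntegral.sum_integral_adjacent_intervals fun i _ => hint _ _, Finset.mul_sum]
    exact Finset.sum_le_sum fun i hi => hstepM i (Finset.mem_range.1 hi)
  -- the two integrals cover `[−m, m]` except the step `[x_{k₀}, x_{k₀+1}]` of length `d`
  have haM0 : aM 0 ≤ -m := by simp only [haM]; push_cast; linarith
  have haMN : aM N = x k₀ := by simp only [haM]; ring
  have haP0 : aP 0 = x (k₀ + 1) := by simp only [haP]; push_cast; ring
  have haPN : m ≤ aP N := by simp only [haP]; linarith
  have hgap : x (k₀ + 1) - x k₀ = d := by simp only [hx]; push_cast; ring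
  have hmid : ∫ y in (x k₀)..(x (k₀ + 1)), g y ≤ d * m := by
    have h := intervalIntegral.integral_mono_on (by linarith [hgap]) (hint (x k₀) (x (k₀ + 1))) intervalIntegrable_const
      (fun y _ => hgm' y)
    rwa [intervalIntegral.integral_const, smul_eq_mul, hgap] at h
  have hcover : ∫ y in (-m)..m, g y ≤ ∫ y in (aM 0)..(aP N), g y :=
    intervalIntegral.integral_mono_interval haM0 (by linarith) haPN
      (Filter.Eventually.of_forall fun y => hg0' y) (hint _ _)
  have hchain : ∫ y in (aM 0)..(aP N), g y =
      (∫ y in (aM 0)..(aM N), g y) + (∫ y in (x k₀)..(x (k₀ + 1)), g y) + ∫ y in (aP 0)..(aP N), g y := by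
    rw [haMN, haP0, intervalIntegral.integral_add_adjacent_intervals (hint _ _) (hint _ _),
      intervalIntegral.integral_add_adjacent_intervals (hint _ _) (hint _ _)]
  -- the two index blocks inside `K`
  set IM : Finset ℤ := (Finset.range N).image fun i : ℕ => k₀ - N + 1 + i with hIM
  set IP : Finset ℤ := (Finset.range N).image fun i : ℕ => k₀ + 1 + i with hIP
  have hinjM : Set.InjOn (fun i : ℕ => k₀ - N + 1 + (i : ℤ)) ↑(Finset.range N) := fun i _ j _ h => by simpa using h
  have hinjP : Set.InjOn (fun i : ℕ => k₀ + 1 + (i : ℤ)) ↑(Finset.range N) := fun i _ j _ h => by simpa using h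
  have hSM : ∑ i ∈ Finset.range N, g (x (k₀ - N + 1 + i)) = ∑ k ∈ IM, g (x k) := by rw [hIM, Finset.sum_image hinjM]
  have hSP : ∑ i ∈ Finset.range N, g (x (k₀ + 1 + i)) = ∑ k ∈ IP, g (x k) := by rw [hIP, Finset.sum_image hinjP]
  have hdisj : Disjoint IM IP := by
    rw [hIM, hIP, Finset.disjoint_left]
    intro k hk hk'
    obtain ⟨i, hi, rfl⟩ := Finset.mem_image.1 hk
    obtain ⟨j, _, hj⟩ := Finset.mem_image.1 hk'
    have hi' := Finset.mem_range.1 hi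
    omega
  have hIK : ∑ k ∈ IM ∪ IP, g (x k) ≤ ∑ k ∈ K, g (x k) := by
    have hzero : ∀ k ∈ IM ∪ IP, k ∉ (IM ∪ IP).filter (fun k => k ∈ K) → g (x k) = 0 := by
      intro k hk hk'
      have hkK : k ∉ K := fun h => hk' (Finset.mem_filter.2 ⟨hk, h⟩)
      have hsq : ¬ ((k : ℝ) * d + c) ^ 2 < m ^ 2 := fun h => hkK (hK k h)
      rw [hg, max_eq_left (by push Not at hsq; simp only [hx]; linarith), Real.sqrt_zero]
    rw [← Finset.sum_subset (Finset.filter_subset (fun k => k ∈ K) (IM ∪ IP)) hzero]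
    exact Finset.sum_le_sum_of_subset_of_nonneg (fun k hk => (Finset.mem_filter.1 hk).2) fun k _ _ => hg0' _
  rw [Finset.sum_union hdisj] at hIK
  -- assemble
  have hkey : Real.pi * m ^ 2 / 2 - d * m ≤ d * (∑ k ∈ IM, g (x k) + ∑ k ∈ IP, g (x k)) := by
    rw [mul_add, ← hSM, ← hSP]
    linarith [hcover, hchain, hmid, hsumP, hsumM, hItot]
  have hfin : Real.pi * m ^ 2 / (2 * d) - m ≤ ∑ k ∈ IM, g (x k) + ∑ k ∈ IP, g (x k) := by
    rw [div_sub' (by positivity : (2 * d) ≠ 0), div_le_iff₀ (by positivity)]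
    nlinarith [hkey]
  exact hfin.trans hIK

/-! ## The flux of one plate against the area, in the verbatim summand shape of the pooled theorems -/

/-- **The core window estimate (no admissibility weights).**  With `S = √(1 − ν²)`, `m = (ρ−4)·S`, `c = ψ − z·ν`, `Φ = 4V/(√3 (1 − ν²))`,
`G_k = √(((ρ−4)²(1−ν²) − (k√(2/3) + ψ − zν)²)₊)` and the canonical window `Kw⋆ = Icc ⌈(−m − c)/√(2/3)⌉ ⌊(m − c)/√(2/3)⌋`:
`√2·π·V·(ρ−4)² − 5·n·ρ ≤ Σ_{k ∈ Kw⋆} (Φ·G_k − n)` (`0 ≤ V ≤ n·S`, `ν² ≤ 1`, `ρ ≥ 4`). -/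
theorem plate_window_core (V ν ψ z ρ : ℝ) (n : ℕ)
    (hρ : 4 ≤ ρ) (hν : ν ^ 2 ≤ 1) (hV0 : 0 ≤ V) (hVS : V ≤ n * Real.sqrt (1 - ν ^ 2)) :
    Real.sqrt 2 * Real.pi * V * (ρ - 4) ^ 2 - 5 * n * ρ ≤
      ∑ k ∈ Finset.Icc ⌈(-((ρ - 4) * Real.sqrt (1 - ν ^ 2)) - (ψ - z * ν)) / Real.sqrt (2 / 3)⌉
          ⌊((ρ - 4) * Real.sqrt (1 - ν ^ 2) - (ψ - z * ν)) / Real.sqrt (2 / 3)⌋,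
        (4 * V / (Real.sqrt 3 * (1 - ν ^ 2)) *
            Real.sqrt (max 0 ((ρ - 4) ^ 2 * (1 - ν ^ 2) - ((k : ℝ) * Real.sqrt (2 / 3) + ψ - z * ν) ^ 2)) -
          (n : ℝ)) := by
  set S : ℝ := Real.sqrt (1 - ν ^ 2) with hS
  set m : ℝ := (ρ - 4) * S with hm
  set c : ℝ := ψ - z * ν with hc
  set d : ℝ := Real.sqrt (2 / 3) with hd
  set K : Finset ℤ := Finset.Icc ⌈(-m - c) / d⌉ ⌊(m - c) / d⌋ with hK
  set Φ : ℝ := 4 * V / (Real.sqrt 3 * (1 - ν ^ 2)) with hΦ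
  have hS2 : 0 ≤ 1 - ν ^ 2 := by linarith
  have hS0 : 0 ≤ S := Real.sqrt_nonneg _
  have hS1 : S ≤ 1 := by
    rw [hS]; calc Real.sqrt (1 - ν ^ 2) ≤ Real.sqrt 1 := Real.sqrt_le_sqrt (by nlinarith [sq_nonneg ν])
      _ = 1 := Real.sqrt_one
  have hSS : S ^ 2 = 1 - ν ^ 2 := by rw [hS, Real.sq_sqrt hS2]
  have hm0 : 0 ≤ m := mul_nonneg (by linarith) hS0
  have hd0 : 0 < d := by rw [hd]; positivity
  have hd81 : (0.81 : ℝ) ≤ d := by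
    rw [hd, show (0.81 : ℝ) = Real.sqrt (0.81 ^ 2) by rw [Real.sqrt_sq (by norm_num)]]
    exact Real.sqrt_le_sqrt (by norm_num)
  have h3 : (1.73 : ℝ) ≤ Real.sqrt 3 := by
    rw [show (1.73 : ℝ) = Real.sqrt (1.73 ^ 2) by rw [Real.sqrt_sq (by norm_num)]]
    exact Real.sqrt_le_sqrt (by norm_num)
  have hΦ0 : 0 ≤ Φ := by rw [hΦ]; positivity
  -- the profile in the abstract shape
  have hG : ∀ k : ℤ, Real.sqrt (max 0 ((ρ - 4) ^ 2 * (1 - ν ^ 2) - ((k : ℝ) * Real.sqrt (2 / 3) + ψ - z * ν) ^ 2)) =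
      Real.sqrt (max 0 (m ^ 2 - ((k : ℝ) * d + c) ^ 2)) := by
    intro k
    have : (ρ - 4) ^ 2 * (1 - ν ^ 2) - ((k : ℝ) * Real.sqrt (2 / 3) + ψ - z * ν) ^ 2 = m ^ 2 - ((k : ℝ) * d + c) ^ 2 := by
      rw [hm, mul_pow, hSS, hd, hc]; ring
    rw [this]
  -- the sum is `Φ Σ G − n #K`
  have hsum : ∑ k ∈ K, (Φ * Real.sqrt (max 0 ((ρ - 4) ^ 2 * (1 - ν ^ 2) - ((k : ℝ) * Real.sqrt (2 / 3) + ψ - z * ν) ^ 2)) - (n : ℝ)) =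
      Φ * ∑ k ∈ K, Real.sqrt (max 0 (m ^ 2 - ((k : ℝ) * d + c) ^ 2)) - (n : ℝ) * K.card := by
    rw [Finset.mul_sum, Finset.card_eq_sum_ones, Nat.cast_sum, Finset.mul_sum, ← Finset.sum_sub_distrib]
    refine Finset.sum_congr rfl fun k _ => ?_
    rw [hG k]; push_cast; ring
  -- the Riemann lower sum and the window size
  have hRiem : Real.pi * m ^ 2 / (2 * d) - m ≤ ∑ k ∈ K, Real.sqrt (max 0 (m ^ 2 - ((k : ℝ) * d + c) ^ 2)) := by
    refine disc_profile_ap_sum_ge m d c hm0 hd0 K fun k hk => ?_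
    have hlt : |(k : ℝ) * d + c| < |m| := sq_lt_sq.1 hk
    rw [abs_of_nonneg hm0] at hlt
    obtain ⟨h1, h2⟩ := abs_lt.1 hlt
    rw [hK, Finset.mem_Icc]
    exact ⟨Int.ceil_le.2 (by rw [div_le_iff₀ hd0]; linarith), Int.le_floor.2 (by rw [le_div_iff₀ hd0]; linarith)⟩
  have hcard : (K.card : ℝ) ≤ (m - c) / d - (-m - c) / d + 1 := by
    refine card_int_le_of_mem_Icc K (by rw [div_le_div_iff_of_pos_right hd0]; linarith) fun k hk => ?_
    rw [hK, Finset.mem_Icc] at hk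
    exact ⟨Int.ceil_le.1 hk.1, Int.le_floor.1 hk.2⟩
  have hcard' : (K.card : ℝ) ≤ 2 * m / d + 1 := by
    have : (m - c) / d - (-m - c) / d = 2 * m / d := by field_simp; ring
    linarith
  -- the main term: `Φ · π m²/(2d) = √2 π V (ρ−4)²`
  have hmain : Φ * (Real.pi * m ^ 2 / (2 * d)) = Real.sqrt 2 * Real.pi * V * (ρ - 4) ^ 2 := by
    rcases eq_or_lt_of_le hS2 with h0 | hpos
    · -- degenerate tilt: `S = 0`, hence `V = 0`
      have hS00 : S = 0 := by rw [hS, ← h0, Real.sqrt_zero]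
      have hV00 : V = 0 := le_antisymm (by rw [hS00, mul_zero] at hVS; exact hVS) hV0
      rw [hΦ, hV00]; ring
    · have hne : (1 - ν ^ 2) ≠ 0 := hpos.ne'
      have h3ne : Real.sqrt 3 ≠ 0 := by positivity
      have hdne : d ≠ 0 := hd0.ne'
      have hsd : Real.sqrt 3 * d = Real.sqrt 2 := by rw [hd, ← Real.sqrt_mul (by norm_num : (0:ℝ) ≤ 3)]; norm_num
      have h22 : (2 : ℝ) / Real.sqrt 2 = Real.sqrt 2 := by
        rw [div_eq_iff (by positivity), Real.mul_self_sqrt (by norm_num)]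
      calc Φ * (Real.pi * m ^ 2 / (2 * d))
          = 4 * V / (Real.sqrt 3 * (1 - ν ^ 2)) * (Real.pi * ((ρ - 4) ^ 2 * (1 - ν ^ 2)) / (2 * d)) := by
            rw [hΦ, hm, mul_pow, hSS]
        _ = 2 * V * Real.pi * (ρ - 4) ^ 2 / (Real.sqrt 3 * d) := by field_simp; ring
        _ = Real.sqrt 2 * Real.pi * V * (ρ - 4) ^ 2 := by
            rw [hsd, show 2 * V * Real.pi * (ρ - 4) ^ 2 / Real.sqrt 2 = (2 / Real.sqrt 2) * (V * Real.pi * (ρ - 4) ^ 2) by ring,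
              h22]; ring
  -- the error terms: `Φ m ≤ (4/√3)·n·(ρ−4)` and `n·#K ≤ n·(2m/d + 1)`
  have hΦm : Φ * m ≤ 2.32 * n * (ρ - 4) := by
    rcases eq_or_lt_of_le hS0 with h0 | hpos
    · have hm00 : m = 0 := by rw [hm, ← h0, mul_zero]
      rw [hm00, mul_zero]
      exact mul_nonneg (mul_nonneg (by norm_num) (Nat.cast_nonneg n)) (by linarith)
    · -- `Φ m = 4 V (ρ−4) / (√3 S) ≤ 4 n (ρ−4)/√3`
      have hVS' : V / S ≤ n := by rw [div_le_iff₀ hpos]; exact hVS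
      rw [show Φ * m = 4 / Real.sqrt 3 * (V / S) * (ρ - 4) by rw [hΦ, hm, ← hSS]; field_simp]
      have h43 : 4 / Real.sqrt 3 ≤ 2.32 := by rw [div_le_iff₀ (by positivity)]; linarith
      have hρ4 : 0 ≤ ρ - 4 := by linarith
      have hVS0 : 0 ≤ V / S := div_nonneg hV0 hS0
      calc 4 / Real.sqrt 3 * (V / S) * (ρ - 4) ≤ 2.32 * (V / S) * (ρ - 4) := by gcongr
        _ ≤ 2.32 * n * (ρ - 4) := by gcongr
  have hnK : (n : ℝ) * K.card ≤ n * (2.47 * (ρ - 4) + 1) := by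
    refine mul_le_mul_of_nonneg_left (hcard'.trans ?_) (Nat.cast_nonneg n)
    have h2d : 2 * m / d ≤ 2.47 * (ρ - 4) := by
      rw [div_le_iff₀ hd0, hm]
      have hρ4 : 0 ≤ ρ - 4 := by linarith
      nlinarith [mul_nonneg hρ4 hS0, mul_le_mul_of_nonneg_left hS1 hρ4]
    linarith
  -- assemble
  have hΦsum : Φ * (Real.pi * m ^ 2 / (2 * d) - m) ≤ Φ * ∑ k ∈ K, Real.sqrt (max 0 (m ^ 2 - ((k : ℝ) * d + c) ^ 2)) :=
    mul_le_mul_of_nonneg_left hRiem hΦ0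
  rw [hsum]
  have hn0 : (0 : ℝ) ≤ n := Nat.cast_nonneg n
  nlinarith [hΦsum, hmain, hΦm, hnK, hn0, mul_nonneg hn0 (show (0:ℝ) ≤ ρ - 4 by linarith)]

open scoped Classical in
/-- **FLUX-TO-AREA for one plate, all window layers admissible.**  In the notation of the module docstring (the summand is VERBATIM the
one of `hexagon_twoPlate_flux_le_payerSum`): with `S = √(1 − ν²)`, `m = (ρ−4)·S`, `c = ψ − z·ν` and the canonical window
`Kw⋆ = Icc ⌈(−m − c)/√(2/3)⌉ ⌊(m − c)/√(2/3)⌋` (every layer whose trace meets the disc of radius `ρ − 4`), if every layer of `Kw⋆` is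
`t`-admissible then `√2·π·V·(ρ−4)² − 5·n·ρ ≤ flux_t(Kw⋆)` (`0 ≤ V ≤ n·S`, `ν² ≤ 1`, `ρ ≥ 4`). -/
theorem plate_flux_ge_area (σ : ℤ → ℤ) (t : ℤ) (V ν ψ z ρ : ℝ) (n : ℕ)
    (hρ : 4 ≤ ρ) (hν : ν ^ 2 ≤ 1) (hV0 : 0 ≤ V) (hVS : V ≤ n * Real.sqrt (1 - ν ^ 2))
    (hadm : ∀ k ∈ Finset.Icc ⌈(-((ρ - 4) * Real.sqrt (1 - ν ^ 2)) - (ψ - z * ν)) / Real.sqrt (2 / 3)⌉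
        ⌊((ρ - 4) * Real.sqrt (1 - ν ^ 2) - (ψ - z * ν)) / Real.sqrt (2 / 3)⌋, ¬ (σ (k - 1) = -t ∧ σ k = -t)) :
    Real.sqrt 2 * Real.pi * V * (ρ - 4) ^ 2 - 5 * n * ρ ≤
      ∑ k ∈ Finset.Icc ⌈(-((ρ - 4) * Real.sqrt (1 - ν ^ 2)) - (ψ - z * ν)) / Real.sqrt (2 / 3)⌉
          ⌊((ρ - 4) * Real.sqrt (1 - ν ^ 2) - (ψ - z * ν)) / Real.sqrt (2 / 3)⌋,
        (if ¬ (σ (k - 1) = -t ∧ σ k = -t) then (1 : ℝ) else 0) *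
          (4 * V / (Real.sqrt 3 * (1 - ν ^ 2)) *
              Real.sqrt (max 0 ((ρ - 4) ^ 2 * (1 - ν ^ 2) - ((k : ℝ) * Real.sqrt (2 / 3) + ψ - z * ν) ^ 2)) -
            (n : ℝ)) := by
  refine (plate_window_core V ν ψ z ρ n hρ hν hV0 hVS).trans (le_of_eq (Finset.sum_congr rfl fun k hk => ?_))
  rw [if_pos (hadm k hk), one_mul]

open scoped Classical in
/-- **FLUX-TO-AREA for one plate, TWO TYPES, any word.**  For two different types `t ≠ t'` every layer is admissible for at least one of them
(`σ(k−1)` cannot equal both `−t` and `−t'`), so on the PROFITABLE window `Kw⋆⋆ = {k ∈ Kw⋆ : n ≤ Φ·G_k}` the two fluxes together dominate the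
single-type bound: `√2·π·V·(ρ−4)² − 5·n·ρ ≤ flux_t(Kw⋆⋆) + flux_{t'}(Kw⋆⋆)` (no admissibility hypothesis). -/
theorem plate_flux_two_types_ge_area (σ : ℤ → ℤ) {t t' : ℤ} (htt' : t ≠ t') (V ν ψ z ρ : ℝ) (n : ℕ)
    (hρ : 4 ≤ ρ) (hν : ν ^ 2 ≤ 1) (hV0 : 0 ≤ V) (hVS : V ≤ n * Real.sqrt (1 - ν ^ 2)) :
    Real.sqrt 2 * Real.pi * V * (ρ - 4) ^ 2 - 5 * n * ρ ≤
      ∑ k ∈ (Finset.Icc ⌈(-((ρ - 4) * Real.sqrt (1 - ν ^ 2)) - (ψ - z * ν)) / Real.sqrt (2 / 3)⌉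
          ⌊((ρ - 4) * Real.sqrt (1 - ν ^ 2) - (ψ - z * ν)) / Real.sqrt (2 / 3)⌋).filter (fun k : ℤ =>
            (n : ℝ) ≤ 4 * V / (Real.sqrt 3 * (1 - ν ^ 2)) *
              Real.sqrt (max 0 ((ρ - 4) ^ 2 * (1 - ν ^ 2) - ((k : ℝ) * Real.sqrt (2 / 3) + ψ - z * ν) ^ 2))),
        (if ¬ (σ (k - 1) = -t ∧ σ k = -t) then (1 : ℝ) else 0) *
          (4 * V / (Real.sqrt 3 * (1 - ν ^ 2)) *
              Real.sqrt (max 0 ((ρ - 4) ^ 2 * (1 - ν ^ 2) - ((k : ℝ) * Real.sqrt (2 / 3) + ψ - z * ν) ^ 2)) -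
            (n : ℝ)) +
      ∑ k ∈ (Finset.Icc ⌈(-((ρ - 4) * Real.sqrt (1 - ν ^ 2)) - (ψ - z * ν)) / Real.sqrt (2 / 3)⌉
          ⌊((ρ - 4) * Real.sqrt (1 - ν ^ 2) - (ψ - z * ν)) / Real.sqrt (2 / 3)⌋).filter (fun k : ℤ =>
            (n : ℝ) ≤ 4 * V / (Real.sqrt 3 * (1 - ν ^ 2)) *
              Real.sqrt (max 0 ((ρ - 4) ^ 2 * (1 - ν ^ 2) - ((k : ℝ) * Real.sqrt (2 / 3) + ψ - z * ν) ^ 2))),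
        (if ¬ (σ (k - 1) = -t' ∧ σ k = -t') then (1 : ℝ) else 0) *
          (4 * V / (Real.sqrt 3 * (1 - ν ^ 2)) *
              Real.sqrt (max 0 ((ρ - 4) ^ 2 * (1 - ν ^ 2) - ((k : ℝ) * Real.sqrt (2 / 3) + ψ - z * ν) ^ 2)) -
            (n : ℝ)) := by
  set K : Finset ℤ := Finset.Icc ⌈(-((ρ - 4) * Real.sqrt (1 - ν ^ 2)) - (ψ - z * ν)) / Real.sqrt (2 / 3)⌉
      ⌊((ρ - 4) * Real.sqrt (1 - ν ^ 2) - (ψ - z * ν)) / Real.sqrt (2 / 3)⌋ with hK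
  set f : ℤ → ℝ := fun k => 4 * V / (Real.sqrt 3 * (1 - ν ^ 2)) *
      Real.sqrt (max 0 ((ρ - 4) ^ 2 * (1 - ν ^ 2) - ((k : ℝ) * Real.sqrt (2 / 3) + ψ - z * ν) ^ 2)) - (n : ℝ) with hf
  have hcore : Real.sqrt 2 * Real.pi * V * (ρ - 4) ^ 2 - 5 * n * ρ ≤ ∑ k ∈ K, f k := plate_window_core V ν ψ z ρ n hρ hν hV0 hVS
  -- drop the unprofitable layers
  have hfilter : ∑ k ∈ K, f k ≤ ∑ k ∈ K.filter (fun k : ℤ => (n : ℝ) ≤ 4 * V / (Real.sqrt 3 * (1 - ν ^ 2)) *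
      Real.sqrt (max 0 ((ρ - 4) ^ 2 * (1 - ν ^ 2) - ((k : ℝ) * Real.sqrt (2 / 3) + ψ - z * ν) ^ 2))), f k := by
    rw [← Finset.sum_filter_add_sum_filter_not K (fun k : ℤ => (n : ℝ) ≤ 4 * V / (Real.sqrt 3 * (1 - ν ^ 2)) *
      Real.sqrt (max 0 ((ρ - 4) ^ 2 * (1 - ν ^ 2) - ((k : ℝ) * Real.sqrt (2 / 3) + ψ - z * ν) ^ 2))) f]
    have hneg : ∑ k ∈ K.filter (fun k : ℤ => ¬ (n : ℝ) ≤ 4 * V / (Real.sqrt 3 * (1 - ν ^ 2)) *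
        Real.sqrt (max 0 ((ρ - 4) ^ 2 * (1 - ν ^ 2) - ((k : ℝ) * Real.sqrt (2 / 3) + ψ - z * ν) ^ 2))), f k ≤ 0 :=
      Finset.sum_nonpos fun k hk => by
        have h := (Finset.mem_filter.1 hk).2
        simp only [hf]; linarith [not_le.1 h]
    linarith
  -- on the profitable layers the two weights add up to at least one
  have hpoint : ∀ k ∈ K.filter (fun k : ℤ => (n : ℝ) ≤ 4 * V / (Real.sqrt 3 * (1 - ν ^ 2)) *
      Real.sqrt (max 0 ((ρ - 4) ^ 2 * (1 - ν ^ 2) - ((k : ℝ) * Real.sqrt (2 / 3) + ψ - z * ν) ^ 2))),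
      f k ≤ (if ¬ (σ (k - 1) = -t ∧ σ k = -t) then (1 : ℝ) else 0) * f k +
        (if ¬ (σ (k - 1) = -t' ∧ σ k = -t') then (1 : ℝ) else 0) * f k := by
    intro k hk
    have hfk : 0 ≤ f k := by have h := (Finset.mem_filter.1 hk).2; simp only [hf]; linarith
    by_cases h1 : (σ (k - 1) = -t ∧ σ k = -t)
    · have h2 : ¬ (σ (k - 1) = -t' ∧ σ k = -t') := fun h2 => htt' (by have := h1.1.symm.trans h2.1; omega)
      rw [if_neg (not_not.2 h1), if_pos h2]; linarith
    · rw [if_pos h1]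
      split_ifs <;> linarith
  have hsplit := Finset.sum_le_sum hpoint
  rw [Finset.sum_add_distrib] at hsplit
  exact hcore.trans (hfilter.trans hsplit)

end Summit.Ventures.Crystal3D.Theorems

end
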